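import Summits.FinalStateConjecture.FinalStateConjecture.Theses.ZeroEnergyKerrOrBomb
import Summits.FinalStateConjecture.FinalStateConjecture.Theorems.ErgoregionBomb.Negative.GrowthLaw
import Summits.FinalStateConjecture.FinalStateConjecture.Theorems.KerrOrBomb.Negative.ModeStabilityAnatomy
import Summits.FinalStateConjecture.FinalStateConjecture.Theorems.ZeroEnergyRigidity.Negative.MinkowskiNoHorizon
import Literature.Geometry.Lorentzian.KillingModeStability
import Literature.Geometry.Lorentzian.ZeroEnergyRayTrappedModFlow
import Literature.Geometry.Lorentzian.GeodesicProofs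
import Literature.Geometry.Lorentzian.StationaryBlackHoleUniquenessProofs

/-!
# Disproof of `ErgoregionBombModT` — findings (cdisprove, crux stmt-FinalStateConjecture-17838,
# route ZeroEnergyKerrOrBomb rev 9; refuter-cdisprove-stmt-FinalStateConjecture-17838-0, cycle 1, 2026-08-17)

The crux (rank 3, the "bomb" branch of the dichotomy): for every hole `𝓑` of the telescope
(vacuum, `I⁺`-regular, future-presented, `T ≠ 0` on a simply connected d.o.c., Killing–timelike
collar `(U, K)` on a connected horizon, closed ergoregion off the collar compact mod `T`), a MAXIMAL
null geodesic with `g(γ̇, γ̇) = 0`, `γ̇ ≠ 0`, `g(γ̇, T) = 0` on its whole (open-interval, non-empty)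
domain `s`, lying in the `T`-orbit of a compact `S ⊆ doc`, forces an exponentially growing
Killing-mode pair (`ν > 0`, smooth near `doc ∪ 𝓗⁺`, `□ψ = □χ = 0`, `Tψ = νψ − ωχ`, `Tχ = ωψ + νχ`
on `doc`, bounded on `doc ∩ I⁻(far slice region)`, `≢ 0` on `doc`).

VERDICT (cycle 1). **No kill.** Everything below is `sorry`-free; axioms
`propext / Classical.choice / Quot.sound`.

* §0 BOOKKEEPING. `ergoregionBombModT_iff` — the crux is, verbatim up to currying,
  `∀ telescope 𝓑, 𝓑.HasZeroEnergyRayTrappedModFlow → ¬ 𝓑.IsKillingModeStable` (tree predicates,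
  `ZeroEnergyRayTrappedModFlow.lean` / `KillingModeStability.lean`); `ergoregionBombModT_iff_telescope`
  (prefix bundled as `Telescope 𝓑 U K`); `ergoregionBombModT_iff_noFacts` — the instance binder
  `[Kerr.Facts]` is inhabited (`kerrFacts`) hence removable; `ergoregionBombModT_iff_noDarkHair` — the
  kill criterion: `¬ crux ↔ DarkHairHole` (a Killing-mode-STABLE telescope hole with a zero-energy
  null geodesic trapped mod `T`).
* §1 LOCALISATION / MINIMAL ANTECEDENT. The trapped ray runs in `doc ∩ {g(T,T) ≥ 0}` (`ray_mem_doc`,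
  `killing_sq_nonneg_on_ray`: the orbit of `S ⊆ doc` stays in `doc` by flow-invariance, and a null
  non-zero vector orthogonal to `T` forbids `T` timelike); so a hole with `T` timelike on its d.o.c.
  satisfies the crux VACUOUSLY (`instance_of_timelike_on_doc`; the non-rotating branch once
  Sudarsky–Wald + Chruściel–Galloway give `T` timelike on `doc`). The SMALLEST antecedent a prover
  must bomb: a null GEODESIC `T`-orbit through a d.o.c. point (a "Killing light point": critical
  point of `g(T,T)` on the ergosurface) is a complete zero-energy null geodesic trapped mod `T` with
  `S = {x}` (`hasZeroEnergyRayTrappedModFlow_of_nullGeodesicOrbit`).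
* §2 ONLY TEETH IS `ν > 0`: with `0 < ν` weakened to `0 ≤ ν` the conclusion holds on every
  presentation (`withoutPos_holds`, constant pair, landed `isKillingModePair_const`).
* §3 THE CLAUSE `γ̇ ≠ 0` IS LOAD-BEARING (new in rev 6): the CONSTANT curve at any `x ∈ doc` is a
  maximal geodesic on `univ` with `g(γ̇,γ̇) = g(γ̇,T) = 0` lying in the orbit of `{x}`
  (`constCurve_antecedent`), so the crux with `γ̇ ≠ 0` deleted says "EVERY telescope hole is
  Killing-mode-unstable" (`withoutVelocity_iff_allUnstable`) — false as soon as one telescope hole is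
  mode stable (`withoutVelocity_false_of_stableHole`; sub-extremal Kerr by Whiting 1989 /
  Shlapentokh-Rothman 2015, support item `KerrModeStability`), and it would make the TARGET
  `KerrOrBombModT` vacuously true (`kerrOrBombModT_of_allUnstable`).
* §4 THE BOUNDEDNESS REGION IS LOAD-BEARING (landed p73443 / `ModeStabilityAnatomy`): any witness of
  the conclusion is UNBOUNDED on `doc` (`conclusion_not_docBounded`); the strengthening "bounded on
  `doc`" of the conclusion is unsatisfiable on every presentation (`not_conclusion_docBounded`).
* §5 THE OTHER ANTECEDENT CLAUSES, modulo inhabitants the tree cannot yet build (no Kerr hole is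
  presented INSIDE the telescope: `KerrStationaryBlackHole.lean` stops before `doc = {r > r₊}`,
  `I⁺`-regularity and the collar): MAXIMALITY (`withoutMaximal_false_of`: a mode-stable telescope
  hole with one zero-energy null geodesic SEGMENT in its d.o.c. — any rotating Kerr — refutes the
  crux without inextendibility), the ORBIT clause (`withoutOrbit_false_of`: a mode-stable telescope
  hole with one maximal zero-energy null geodesic ANYWHERE — a horizon generator of Schwarzschild —
  refutes the crux without trapping), ZERO ENERGY (`withoutZeroEnergy_false_of`: a mode-stable hole
  with a null geodesic of any energy trapped mod `T` — the Schwarzschild photon sphere).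
* §6 WHY IT RESISTS (docstrings of `DarkHairHole` and of `false_of_incompleteSpeciesHole`): a countermodel is EXACTLY a dark-hair hole; flat carriers are
  excluded (a complete Killing field timelike on an AF end of Minkowski is `∂ₜ`, timelike
  everywhere: no zero-energy null vector — `minkowskiBH` of the tree has moreover `horizon = ∅`);
  time-periodic quotients (mode-stable for free, landed `isKillingModeStable_of_closed_orbits`) fail
  `IsGloballyHyperbolicSet doc`; the Kerr–Schild Kerr chart has `Γ₀ = ∅` (support
  `KerrZeroEnergyUntrappedKS`). The antecedent admits the INCOMPLETE (anisochronous, blueshifted)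
  species `s ≠ univ`, for which the ideators' negative note (NegativeNotesIdeator1 §4 N3) predicts
  NON-modal growth only — the most plausible failure mode of the crux as typed, but it needs a vacuum
  witness nobody can write down.
-/

noncomputable section

-- instance search through nested operator types `E →L E →L ℝ` (as in the tree files)
set_option maxSynthPendingDepth 3
set_option linter.dupNamespace false

namespace Summit.FinalStateConjecture.FinalStateConjecture.Cruxes.ErgoregionBombModT.Disproof

open Literature.Geometry.Lorentzian
open Summit.FinalStateConjecture.FinalStateConjecture.Theses.ZeroEnergyKerrOrBomb
open Summit.FinalStateConjecture.FinalStateConjecture.Theorems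
open scoped Manifold Topology
open Set Bundle

/-! ## §0  Bookkeeping: the crux bundled through the tree predicates -/

/-- **The telescope** (hypotheses of the crux before its antecedent, bundled): vacuum, `I⁺`-regular,
future-presented, `T ≠ 0` on a simply connected d.o.c., and a Killing–timelike collar `(U, K)` on a
connected horizon with the closed ergoregion off `U` compact modulo `T`. Verbatim the binders of
`ErgoregionBombModT` (and of `NonTrappingHawkingRigidity`, `KerrOrBombModT`). -/
def Telescope (𝓑 : StationaryAFBlackHole.{0}) [𝓑.metric.HasLeviCivita] (U : Set 𝓑.carrier)
    (K : Π x : 𝓑.carrier, TangentSpace (𝓡 4) x) : Prop :=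
  𝓑.metric.toPseudoRiemannianMetric.IsRicciFlat ∧ 𝓑.IsIPlusRegular ∧
  (∀ p : 𝓑.carrier, p ∈ 𝓑.metric.chronologicalFuture 𝓑.timeOrientation 𝓑.Mext) ∧
  (∀ p ∈ 𝓑.doc, 𝓑.killing p ≠ 0) ∧ SimplyConnectedSpace 𝓑.doc ∧
  IsOpen U ∧ 𝓑.horizon ⊆ U ∧ IsConnected 𝓑.horizon ∧
  ContMDiffOn (𝓡 4) ((𝓡 4).prod 𝓘(ℝ, E4)) ((⊤ : ℕ∞) : WithTop ℕ∞)
    (fun x ↦ (TotalSpace.mk' E4 x (K x) : TangentBundle (𝓡 4) 𝓑.carrier)) U ∧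
  (∀ x ∈ U, ∀ v w : TangentSpace (𝓡 4) x, 𝓑.metric.val x (𝓑.metric.leviCivita K x v) w +
    𝓑.metric.val x v (𝓑.metric.leviCivita K x w) = 0) ∧
  (∀ x ∈ U, VectorField.mlieBracket (𝓡 4) 𝓑.killing K x = 0) ∧ (∀ p ∈ 𝓑.horizon, K p ≠ 0) ∧
  (∀ γ : ℝ → 𝓑.carrier, IsMIntegralCurve γ K → γ 0 ∈ 𝓑.horizon → ∀ t, γ t ∈ 𝓑.horizon) ∧
  (∀ x ∈ U ∩ 𝓑.doc, 𝓑.metric.val x (K x) (K x) < 0) ∧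
  ∃ S₀ : Set 𝓑.carrier, IsCompact S₀ ∧ S₀ ⊆ 𝓑.doc ∧ ∀ y ∈ 𝓑.doc,
    0 ≤ 𝓑.metric.val y (𝓑.killing y) (𝓑.killing y) → y ∉ U → y ∈ stationaryOrbit 𝓑.killing S₀

/-- **The crux bundled**: `ErgoregionBombModT` says exactly that every telescope hole with a
zero-energy null geodesic trapped modulo the stationary flow (`HasZeroEnergyRayTrappedModFlow`) is
NOT Killing-mode stable (`IsKillingModeStable`). Pure currying
(`not_isKillingModeStable_iff_exists_isKillingModePair`). [folklore] -/
theorem ergoregionBombModT_iff_telescope : ErgoregionBombModT ↔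
    ∀ (𝓑 : StationaryAFBlackHole.{0}) [𝓑.metric.HasLeviCivita] [Kerr.Facts]
      (U : Set 𝓑.carrier) (K : Π x : 𝓑.carrier, TangentSpace (𝓡 4) x),
      Telescope 𝓑 U K → 𝓑.HasZeroEnergyRayTrappedModFlow → ¬ 𝓑.IsKillingModeStable := by
  unfold ErgoregionBombModT Telescope
  constructor
  · rintro h 𝓑 _ _ U K ⟨h1, h2, h3, h4, h5, hU, hHU, hc, hK, hKill, hbr, hK0, htan, htl, hbelt⟩
      ⟨S, hS, hSd, γ, s, hγ, hs, hz, hin⟩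
    rw [StationaryAFBlackHole.not_isKillingModeStable_iff_exists_isKillingModePair]
    obtain ⟨ν, ω, ψ, χ, hν, hU', hW, hE, hB, hx⟩ :=
      h 𝓑 h1 h2 h3 h4 h5 U K hU hHU hc hK hKill hbr hK0 htan htl hbelt S hS hSd γ s hγ hs hz hin
    exact ⟨ν, ω, ψ, χ, hν, ⟨hU', hW, hE, hB⟩, hx⟩
  · intro h 𝓑 _ _ h1 h2 h3 h4 h5 U K hU hHU hc hK hKill hbr hK0 htan htl hbelt S hS hSd γ s hγ hs hz hin
    have := h 𝓑 U K ⟨h1, h2, h3, h4, h5, hU, hHU, hc, hK, hKill, hbr, hK0, htan, htl, hbelt⟩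
      ⟨S, hS, hSd, γ, s, hγ, hs, hz, hin⟩
    rw [StationaryAFBlackHole.not_isKillingModeStable_iff_exists_isKillingModePair] at this
    obtain ⟨ν, ω, ψ, χ, hν, ⟨hU', hW, hE, hB⟩, hx⟩ := this
    exact ⟨ν, ω, ψ, χ, hν, hU', hW, hE, hB, hx⟩

/-- **The instance binder `[Kerr.Facts]` is removable** (it is inhabited: `kerrFacts`, all three
fields being theorems of the tree), so provers may drop it and refuters gain nothing from it. [folklore] -/
theorem ergoregionBombModT_iff_noFacts : ErgoregionBombModT ↔
    ∀ (𝓑 : StationaryAFBlackHole.{0}) [𝓑.metric.HasLeviCivita]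
      (U : Set 𝓑.carrier) (K : Π x : 𝓑.carrier, TangentSpace (𝓡 4) x),
      Telescope 𝓑 U K → 𝓑.HasZeroEnergyRayTrappedModFlow → ¬ 𝓑.IsKillingModeStable := by
  rw [ergoregionBombModT_iff_telescope]
  haveI : Kerr.Facts := ZeroEnergyRigidity.Negative.kerrFacts
  exact ⟨fun h 𝓑 _ U K ↦ h 𝓑 U K, fun h 𝓑 _ _ U K ↦ h 𝓑 U K⟩

/-- **Dark hair**: a telescope hole which IS Killing-mode stable and nevertheless carries a
zero-energy null geodesic trapped modulo the flow. Its existence is open: it would be a smooth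
stationary vacuum black hole other than Kerr (Kerr has `Γ₀ = ∅`: support `KerrZeroEnergyUntrappedKS`),
i.e. a counterexample to smooth black-hole uniqueness in the trapping class, which moreover beats the
Friedman/Press–Teukolsky amplification (horizon absorption quenching every `Γ₀`-fed quasimode; the
ideators' negative notes single out the INCOMPLETE, anisochronous species of trapped rays — domain
`s ≠ univ`, blueshifted in one direction — as the one for which only NON-modal growth is expected).
Nothing in print exhibits one (Moschidis arXiv:1608.02041 Thm 2 is non-vacuum far from the hole;
arXiv:1608.02035 and Keir arXiv:1609.01733 / 1810.03026 are horizonless). -/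
def DarkHairHole : Prop :=
  ∃ (𝓑 : StationaryAFBlackHole.{0}) (_ : 𝓑.metric.HasLeviCivita)
    (U : Set 𝓑.carrier) (K : Π x : 𝓑.carrier, TangentSpace (𝓡 4) x),
    Telescope 𝓑 U K ∧ 𝓑.HasZeroEnergyRayTrappedModFlow ∧ 𝓑.IsKillingModeStable

/-- **Kill criterion**: the crux fails iff a dark-hair hole exists. (So `¬ ErgoregionBombModT` is
exactly as hard as exhibiting dark hair; no cheaper refutation exists.) [folklore] -/
theorem ergoregionBombModT_iff_noDarkHair : ErgoregionBombModT ↔ ¬ DarkHairHole := by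
  rw [ergoregionBombModT_iff_noFacts]
  constructor
  · rintro h ⟨𝓑, _, U, K, hT, hZ, hS⟩
    exact h 𝓑 U K hT hZ hS
  · intro h 𝓑 _ U K hT hZ hS
    exact h ⟨𝓑, ‹_›, U, K, hT, hZ, hS⟩

/-! ## §1  Localisation of the trapped ray; the minimal antecedent -/

variable (𝓑 : StationaryAFBlackHole.{0}) [𝓑.metric.HasLeviCivita]

/-- The `T`-orbit of a subset of the d.o.c. stays in the d.o.c. (flow-invariance of `⟨⟨M_ext⟩⟩`,
`StationaryAFBlackHole.mem_doc_of_isMIntegralCurve`). [cite: ChruscielCosta2008, §2.2 (2.2)] -/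
theorem stationaryOrbit_subset_doc {S : Set 𝓑.carrier} (hSd : S ⊆ 𝓑.doc) :
    stationaryOrbit 𝓑.killing S ⊆ 𝓑.doc := by
  rintro y ⟨σ, hσ, h0, t, rfl⟩
  exact StationaryAFBlackHole.mem_doc_of_isMIntegralCurve hσ (hSd h0) t

/-- **The trapped ray runs in the d.o.c.** (every point of the antecedent's geodesic). [folklore] -/
theorem ray_mem_doc {S : Set 𝓑.carrier} (hSd : S ⊆ 𝓑.doc) {γ : ℝ → 𝓑.carrier} {s : Set ℝ}
    (hin : ∀ t ∈ s, γ t ∈ stationaryOrbit 𝓑.killing S) {t : ℝ} (ht : t ∈ s) : γ t ∈ 𝓑.doc :=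
  stationaryOrbit_subset_doc 𝓑 hSd (hin t ht)

omit [𝓑.metric.HasLeviCivita] in
/-- **The trapped ray runs in the closed ergoregion** `{g(T,T) ≥ 0}`: a non-zero null vector
orthogonal to `T` forbids `T` timelike (O'Neill 1983, Ch. 5, Lemma 5.26; tree lemma
`killing_sq_nonneg_of_zeroEnergyNull`). [cite: ONeill1983, Ch. 5, Lemma 5.26] -/
theorem killing_sq_nonneg_on_ray {γ : ℝ → 𝓑.carrier} {s : Set ℝ}
    (hz : ∀ t ∈ s, 𝓑.metric.val (γ t) (velocity (𝓡 4) γ t) (velocity (𝓡 4) γ t) = 0 ∧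
      velocity (𝓡 4) γ t ≠ 0 ∧ 𝓑.metric.val (γ t) (velocity (𝓡 4) γ t) (𝓑.killing (γ t)) = 0)
    {t : ℝ} (ht : t ∈ s) : 0 ≤ 𝓑.metric.val (γ t) (𝓑.killing (γ t)) (𝓑.killing (γ t)) :=
  𝓑.killing_sq_nonneg_of_zeroEnergyNull (hz t ht).1 (hz t ht).2.1 (hz t ht).2.2

/-- **No ergoregion in the d.o.c., no antecedent**: if `T` is timelike at every point of `doc` then
`¬ 𝓑.HasZeroEnergyRayTrappedModFlow` — so such a hole satisfies the crux VACUOUSLY (next theorem).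
This is where the non-rotating branch ends (K ∥ T on 𝓔⁺ ⇒ Sudarsky–Wald staticity ⇒
Chruściel–Galloway ⇒ `T` timelike on `doc`), and why any countermodel needs an ergoregion reaching
into `⟨⟨M_ext⟩⟩`. [cite: ONeill1983, Ch. 5, Lemma 5.26] -/
theorem not_antecedent_of_timelike_on_doc (hT : ∀ p ∈ 𝓑.doc, 𝓑.metric.IsTimelike (𝓑.killing p)) :
    ¬ 𝓑.HasZeroEnergyRayTrappedModFlow :=
  𝓑.not_hasZeroEnergyRayTrappedModFlow_of_isTimelike fun _ _ hSd x hx ↦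
    hT x (stationaryOrbit_subset_doc 𝓑 hSd hx)

/-- The instance of the crux at a telescope hole with `T` timelike on its d.o.c. holds with no mode
at all. [folklore] -/
theorem instance_of_timelike_on_doc (hT : ∀ p ∈ 𝓑.doc, 𝓑.metric.IsTimelike (𝓑.killing p)) :
    𝓑.HasZeroEnergyRayTrappedModFlow → ¬ 𝓑.IsKillingModeStable :=
  fun h ↦ absurd h (not_antecedent_of_timelike_on_doc 𝓑 hT)

omit [𝓑.metric.HasLeviCivita] in
/-- The velocity of an integral curve of `T` is `T` (Mathlib's `IsMIntegralCurve` unfolded through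
the tree's `velocity`). [folklore] -/
theorem velocity_of_isMIntegralCurve {σ : ℝ → 𝓑.carrier} (hσ : IsMIntegralCurve σ 𝓑.killing)
    (t : ℝ) : velocity (𝓡 4) σ t = 𝓑.killing (σ t) := by
  rw [velocity, (hσ t).mfderiv]
  change ((1 : ℝ →L[ℝ] ℝ) (1 : ℝ)) • 𝓑.killing (σ t) = 𝓑.killing (σ t)
  simp

/-- **The minimal antecedent (Killing light points must bomb).** If the `T`-orbit `σ` through a
point of the d.o.c. is a null GEODESIC (`g(T,T) = 0` along it and `∇_T T = 0`, i.e. `σ 0` is a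
critical point of `g(T,T)` on the ergosurface — a "Killing light point"; affinely parametrised by
Killing time, hence complete), then `𝓑.HasZeroEnergyRayTrappedModFlow` holds with `S = {σ 0}` and
`s = univ`: the orbit is a maximal null geodesic, `γ̇ = T ≠ 0` on `doc`, `g(γ̇, T) = g(T, T) = 0`.
Kerr has none (its ergosurface `r² − 2Mr + a²cos²θ = 0` is a regular level set); a prover of the
crux must nevertheless produce a growing mode from this configuration alone. [folklore] -/
theorem hasZeroEnergyRayTrappedModFlow_of_nullGeodesicOrbit
    (h5 : ∀ p ∈ 𝓑.doc, 𝓑.killing p ≠ 0) {σ : ℝ → 𝓑.carrier}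
    (hσ : IsMIntegralCurve σ 𝓑.killing) (h0 : σ 0 ∈ 𝓑.doc)
    (hgeo : IsGeodesic 𝓑.metric.toPseudoRiemannianMetric.leviCivita σ)
    (hnull : ∀ t, 𝓑.metric.val (σ t) (𝓑.killing (σ t)) (𝓑.killing (σ t)) = 0) :
    𝓑.HasZeroEnergyRayTrappedModFlow := by
  have hdoc : ∀ t, σ t ∈ 𝓑.doc := fun t ↦
    StationaryAFBlackHole.mem_doc_of_isMIntegralCurve hσ h0 t
  refine ⟨{σ 0}, isCompact_singleton, by simpa using h0, σ, univ,
    IsGeodesic.isMaximalGeodesicOn_univ _ hgeo, univ_nonempty, fun t _ ↦ ?_, fun t _ ↦ ?_⟩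
  · rw [velocity_of_isMIntegralCurve 𝓑 hσ t]
    exact ⟨hnull t, h5 _ (hdoc t), hnull t⟩
  · exact ⟨σ, hσ, rfl, t, rfl⟩

/-! ## §2  The only teeth of the conclusion is `ν > 0` -/

/-- **Without `ν > 0` the conclusion is free** on every presentation (constant pair `(1, 0)` of
frequency `0`, landed `KerrOrBomb.Negative.isKillingModePair_const`; the d.o.c. is non-empty,
`StationaryAFBlackHole.doc_nonempty`). So the crux with `0 < ν` weakened to `0 ≤ ν` is a theorem
and every proof must produce STRICT exponential growth. [folklore] -/
theorem withoutPos_holds :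
    ∃ (ν ω : ℝ) (ψ χ : 𝓑.carrier → ℝ), 0 ≤ ν ∧ 𝓑.IsKillingModePair ν ω ψ χ ∧
      ∃ x ∈ 𝓑.doc, ψ x ≠ 0 ∨ χ x ≠ 0 :=
  KerrOrBomb.Negative.exists_isKillingModePair_nonneg_ne_zero 𝓑

/-! ## §3  The clause `γ̇ ≠ 0` is load-bearing: constant curves -/

omit [𝓑.metric.HasLeviCivita] in
/-- The velocity of a constant curve vanishes. [folklore] -/
theorem velocity_const (x : 𝓑.carrier) (t : ℝ) : velocity (𝓡 4) (fun _ : ℝ ↦ x) t = 0 := by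
  simp only [velocity, mfderiv_const]
  rfl

/-- **The constant curve at a point of the d.o.c. meets every clause of the antecedent except
`γ̇ ≠ 0`**: it is a maximal geodesic with domain `univ` (constant curves are geodesics,
`isGeodesic_const_holds`; a geodesic on `ℝ` is maximal), `g(γ̇, γ̇) = g(γ̇, T) = 0` since `γ̇ = 0`,
and it lies in the `T`-orbit of the compact set `{x} ⊆ doc`. [cite: ONeill1983, Ch. 3, p. 69] -/
theorem constCurve_antecedent {x : 𝓑.carrier} (hx : x ∈ 𝓑.doc) :
    IsCompact ({x} : Set 𝓑.carrier) ∧ ({x} : Set 𝓑.carrier) ⊆ 𝓑.doc ∧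
    IsMaximalGeodesicOn 𝓑.metric.toPseudoRiemannianMetric.leviCivita (fun _ : ℝ ↦ x) univ ∧
    (univ : Set ℝ).Nonempty ∧
    (∀ t ∈ (univ : Set ℝ),
      𝓑.metric.val x (velocity (𝓡 4) (fun _ : ℝ ↦ x) t) (velocity (𝓡 4) (fun _ : ℝ ↦ x) t) = 0 ∧
      𝓑.metric.val x (velocity (𝓡 4) (fun _ : ℝ ↦ x) t) (𝓑.killing x) = 0) ∧
    ∀ t ∈ (univ : Set ℝ), (fun _ : ℝ ↦ x) t ∈ stationaryOrbit 𝓑.killing {x} := by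
  refine ⟨isCompact_singleton, by simpa using hx,
    IsGeodesic.isMaximalGeodesicOn_univ _
      (isGeodesic_const_holds 𝓑.metric.toPseudoRiemannianMetric.leviCivita x),
    univ_nonempty, fun t _ ↦ ?_, fun t _ ↦ ?_⟩
  · simp [velocity_const]
  · exact subset_stationaryOrbit 𝓑.isStationaryKilling.isCompleteVectorField _ rfl

/-- **The crux with the clause `velocity γ t ≠ 0` deleted** (everything else verbatim, prefix
bundled as `Telescope`, conclusion as `¬ IsKillingModeStable`). -/
def ErgoregionBombModTWithoutVelocity : Prop :=
  ∀ (𝓑 : StationaryAFBlackHole.{0}) [𝓑.metric.HasLeviCivita] [Kerr.Facts]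
    (U : Set 𝓑.carrier) (K : Π x : 𝓑.carrier, TangentSpace (𝓡 4) x), Telescope 𝓑 U K →
    (∃ S : Set 𝓑.carrier, IsCompact S ∧ S ⊆ 𝓑.doc ∧ ∃ (γ : ℝ → 𝓑.carrier) (s : Set ℝ),
      IsMaximalGeodesicOn 𝓑.metric.toPseudoRiemannianMetric.leviCivita γ s ∧ s.Nonempty ∧
      (∀ t ∈ s, 𝓑.metric.val (γ t) (velocity (𝓡 4) γ t) (velocity (𝓡 4) γ t) = 0 ∧
        𝓑.metric.val (γ t) (velocity (𝓡 4) γ t) (𝓑.killing (γ t)) = 0) ∧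
      ∀ t ∈ s, γ t ∈ stationaryOrbit 𝓑.killing S) →
    ¬ 𝓑.IsKillingModeStable

/-- **Without `γ̇ ≠ 0` the crux says: every telescope hole is Killing-mode-unstable** (the constant
curve at a point of the non-empty d.o.c. discharges the weakened antecedent). [folklore] -/
theorem withoutVelocity_iff_allUnstable : ErgoregionBombModTWithoutVelocity ↔
    ∀ (𝓑 : StationaryAFBlackHole.{0}) [𝓑.metric.HasLeviCivita] [Kerr.Facts]
      (U : Set 𝓑.carrier) (K : Π x : 𝓑.carrier, TangentSpace (𝓡 4) x),
      Telescope 𝓑 U K → ¬ 𝓑.IsKillingModeStable := by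
  constructor
  · intro h 𝓑 _ _ U K hT
    obtain ⟨x, hx⟩ := 𝓑.doc_nonempty
    obtain ⟨hc, hxd, hmax, hne, hz, hin⟩ := constCurve_antecedent 𝓑 hx
    exact h 𝓑 U K hT ⟨{x}, hc, hxd, fun _ ↦ x, univ, hmax, hne, hz, hin⟩
  · intro h 𝓑 _ _ U K hT _
    exact h 𝓑 U K hT

/-- **A mode-stable telescope hole exists** — the non-vacuity of the route's TARGET `KerrOrBombModT`
(every sub-extremal Kerr, incl. Schwarzschild, is claimed to inhabit the telescope with the collar
`K = ∂_{t*} + Ω_H ∂_{φ*}`, and is Killing-mode stable by Whiting 1989 / Shlapentokh-Rothman 2015,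
support item `KerrModeStability`). Not yet constructible in the tree (`KerrStationaryBlackHole.lean`
presents the Kerr–Schild chart as a `StationaryAFBlackHole` but `doc = {r > r₊}`, `I⁺`-regularity
and the collar are open follow-ups). [cite: ShlapentokhRothman2015ModeStability, Thm. 1.5] -/
def StableTelescopeHole : Prop :=
  ∃ (𝓑 : StationaryAFBlackHole.{0}) (_ : 𝓑.metric.HasLeviCivita)
    (U : Set 𝓑.carrier) (K : Π x : 𝓑.carrier, TangentSpace (𝓡 4) x),
    Telescope 𝓑 U K ∧ 𝓑.IsKillingModeStable

/-- **`γ̇ ≠ 0` is load-bearing**: one mode-stable telescope hole refutes the crux without it.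
[cite: ShlapentokhRothman2015ModeStability, Thm. 1.5] -/
theorem withoutVelocity_false_of_stableHole (h : StableTelescopeHole) :
    ¬ ErgoregionBombModTWithoutVelocity := by
  rw [withoutVelocity_iff_allUnstable]
  rintro hall
  obtain ⟨𝓑, _, U, K, hT, hS⟩ := h
  haveI : Kerr.Facts := ZeroEnergyRigidity.Negative.kerrFacts
  exact hall 𝓑 U K hT hS

/-- … and without `γ̇ ≠ 0` the bomb would make the route's TARGET vacuous: if every telescope hole
is mode-unstable, `KerrOrBombModT` holds with no geometry at all. (Remark for the planner; positive
statement about a Theses decl, kept in this work file only.) [folklore] -/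
theorem kerrOrBombModT_of_allUnstable
    (hall : ∀ (𝓑 : StationaryAFBlackHole.{0}) [𝓑.metric.HasLeviCivita] [Kerr.Facts]
      (U : Set 𝓑.carrier) (K : Π x : 𝓑.carrier, TangentSpace (𝓡 4) x),
      Telescope 𝓑 U K → ¬ 𝓑.IsKillingModeStable) : KerrOrBombModT := by
  intro 𝓑 _ _ h1 h2 h3 h4 h5 U K hU hHU hc hK hKill hbr hK0 htan htl hbelt hstable
  exact absurd hstable (hall 𝓑 U K ⟨h1, h2, h3, h4, h5, hU, hHU, hc, hK, hKill, hbr, hK0, htan, htl, hbelt⟩)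

/-! ## §4  The boundedness REGION of the conclusion is load-bearing (landed growth law) -/

variable {𝓑} in
/-- **Any witness of the conclusion is unbounded on the d.o.c.**: a `ν > 0` pair, smooth near
`doc ∪ 𝓗⁺`, satisfying the eigen-equations on `doc` and bounded on the WHOLE d.o.c. vanishes there
(landed `KerrOrBomb.Negative.modePair_eq_zero_of_bounded_on_doc`: growth law
`ψ² + χ² = e^{2ν(t−t₀)}(ψ₀² + χ₀²)` along the complete forward `T`-orbits, which stay in `doc`).
So the mode a prover must build blows up towards the future and is bounded only on
`doc ∩ I⁻(far slice region)`. [folklore] -/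
theorem conclusion_not_docBounded {ν ω : ℝ} {ψ χ : 𝓑.carrier → ℝ} (hν : 0 < ν)
    (hU : ∃ U : Set 𝓑.carrier, IsOpen U ∧ 𝓑.doc ∪ 𝓑.horizon ⊆ U ∧
      ContMDiffOn (𝓡 4) 𝓘(ℝ, ℝ) ((⊤ : ℕ∞) : WithTop ℕ∞) ψ U ∧
      ContMDiffOn (𝓡 4) 𝓘(ℝ, ℝ) ((⊤ : ℕ∞) : WithTop ℕ∞) χ U)
    (heig : ∀ x ∈ 𝓑.doc, mfderiv (𝓡 4) 𝓘(ℝ, ℝ) ψ x (𝓑.killing x) = ν * ψ x - ω * χ x ∧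
      mfderiv (𝓡 4) 𝓘(ℝ, ℝ) χ x (𝓑.killing x) = ω * ψ x + ν * χ x)
    (hx : ∃ x ∈ 𝓑.doc, ψ x ≠ 0 ∨ χ x ≠ 0) :
    ¬ ∃ C : ℝ, ∀ x ∈ 𝓑.doc, |ψ x| ≤ C ∧ |χ x| ≤ C := by
  intro hb
  obtain ⟨x, hxd, hx0⟩ := hx
  have h := KerrOrBomb.Negative.modePair_eq_zero_of_bounded_on_doc hν hU heig hb x hxd
  rcases hx0 with h0 | h0
  · exact h0 h.1
  · exact h0 h.2

/-- **The strengthened conclusion "bounded on `doc`" is unsatisfiable on every presentation** (so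
the crux with that conclusion collapses to "no telescope hole has a zero-energy ray trapped mod T",
i.e. to the rigidity branch). [folklore] -/
theorem not_conclusion_docBounded :
    ¬ ∃ (ν ω : ℝ) (ψ χ : 𝓑.carrier → ℝ), 0 < ν ∧
      (∃ U : Set 𝓑.carrier, IsOpen U ∧ 𝓑.doc ∪ 𝓑.horizon ⊆ U ∧
        ContMDiffOn (𝓡 4) 𝓘(ℝ, ℝ) ((⊤ : ℕ∞) : WithTop ℕ∞) ψ U ∧
        ContMDiffOn (𝓡 4) 𝓘(ℝ, ℝ) ((⊤ : ℕ∞) : WithTop ℕ∞) χ U) ∧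
      (∀ x ∈ 𝓑.doc, 𝓑.metric.dalembertian ψ x = 0 ∧ 𝓑.metric.dalembertian χ x = 0) ∧
      (∀ x ∈ 𝓑.doc, mfderiv (𝓡 4) 𝓘(ℝ, ℝ) ψ x (𝓑.killing x) = ν * ψ x - ω * χ x ∧
        mfderiv (𝓡 4) 𝓘(ℝ, ℝ) χ x (𝓑.killing x) = ω * ψ x + ν * χ x) ∧
      (∃ C : ℝ, ∀ x ∈ 𝓑.doc, |ψ x| ≤ C ∧ |χ x| ≤ C) ∧ ∃ x ∈ 𝓑.doc, ψ x ≠ 0 ∨ χ x ≠ 0 := by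
  rintro ⟨ν, ω, ψ, χ, hν, hU, -, heig, hb, hx⟩
  exact conclusion_not_docBounded hν hU heig hx hb

/-! ## §5  The other clauses of the antecedent, modulo inhabitants -/

/-- **The crux with MAXIMALITY deleted** (`IsMaximalGeodesicOn` replaced by "geodesic on an open
interval"). -/
def ErgoregionBombModTWithoutMaximal : Prop :=
  ∀ (𝓑 : StationaryAFBlackHole.{0}) [𝓑.metric.HasLeviCivita] [Kerr.Facts]
    (U : Set 𝓑.carrier) (K : Π x : 𝓑.carrier, TangentSpace (𝓡 4) x), Telescope 𝓑 U K →
    (∃ S : Set 𝓑.carrier, IsCompact S ∧ S ⊆ 𝓑.doc ∧ ∃ (γ : ℝ → 𝓑.carrier) (s : Set ℝ),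
      (IsOpen s ∧ s.OrdConnected ∧ IsGeodesicOn 𝓑.metric.toPseudoRiemannianMetric.leviCivita γ s) ∧
      s.Nonempty ∧
      (∀ t ∈ s, 𝓑.metric.val (γ t) (velocity (𝓡 4) γ t) (velocity (𝓡 4) γ t) = 0 ∧
        velocity (𝓡 4) γ t ≠ 0 ∧ 𝓑.metric.val (γ t) (velocity (𝓡 4) γ t) (𝓑.killing (γ t)) = 0) ∧
      ∀ t ∈ s, γ t ∈ stationaryOrbit 𝓑.killing S) →
    ¬ 𝓑.IsKillingModeStable

/-- **A mode-stable telescope hole with one zero-energy null geodesic SEGMENT confined, over a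
(possibly tiny) open interval, to the orbit of a compact subset of its d.o.c.** — every rotating
sub-extremal Kerr: through each point of its ergoregion `∩ doc` pass zero-energy null geodesics, and a
compact sub-arc is its own cage. Unconstructible here for the same reason as `StableTelescopeHole`. -/
def StableHoleWithZeroEnergySegment : Prop :=
  ∃ (𝓑 : StationaryAFBlackHole.{0}) (_ : 𝓑.metric.HasLeviCivita)
    (U : Set 𝓑.carrier) (K : Π x : 𝓑.carrier, TangentSpace (𝓡 4) x),
    Telescope 𝓑 U K ∧ 𝓑.IsKillingModeStable ∧
    ∃ S : Set 𝓑.carrier, IsCompact S ∧ S ⊆ 𝓑.doc ∧ ∃ (γ : ℝ → 𝓑.carrier) (s : Set ℝ),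
      (IsOpen s ∧ s.OrdConnected ∧ IsGeodesicOn 𝓑.metric.toPseudoRiemannianMetric.leviCivita γ s) ∧
      s.Nonempty ∧
      (∀ t ∈ s, 𝓑.metric.val (γ t) (velocity (𝓡 4) γ t) (velocity (𝓡 4) γ t) = 0 ∧
        velocity (𝓡 4) γ t ≠ 0 ∧ 𝓑.metric.val (γ t) (velocity (𝓡 4) γ t) (𝓑.killing (γ t)) = 0) ∧
      ∀ t ∈ s, γ t ∈ stationaryOrbit 𝓑.killing S

/-- **Maximality (inextendibility of `γ`) is load-bearing**: a short zero-energy null segment is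
trivially "trapped", so without `IsMaximalGeodesicOn` any rotating mode-stable hole refutes the crux.
[cite: ShlapentokhRothman2015ModeStability, Thm. 1.5] -/
theorem withoutMaximal_false_of (h : StableHoleWithZeroEnergySegment) :
    ¬ ErgoregionBombModTWithoutMaximal := by
  rintro hW
  obtain ⟨𝓑, _, U, K, hT, hS, hseg⟩ := h
  haveI : Kerr.Facts := ZeroEnergyRigidity.Negative.kerrFacts
  exact hW 𝓑 U K hT hseg hS

/-- **The crux with the ORBIT clause deleted** (`∀ t ∈ s, γ t ∈ stationaryOrbit T S` removed; note
that `S` then idles). -/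
def ErgoregionBombModTWithoutOrbit : Prop :=
  ∀ (𝓑 : StationaryAFBlackHole.{0}) [𝓑.metric.HasLeviCivita] [Kerr.Facts]
    (U : Set 𝓑.carrier) (K : Π x : 𝓑.carrier, TangentSpace (𝓡 4) x), Telescope 𝓑 U K →
    (∃ S : Set 𝓑.carrier, IsCompact S ∧ S ⊆ 𝓑.doc ∧ ∃ (γ : ℝ → 𝓑.carrier) (s : Set ℝ),
      IsMaximalGeodesicOn 𝓑.metric.toPseudoRiemannianMetric.leviCivita γ s ∧ s.Nonempty ∧
      (∀ t ∈ s, 𝓑.metric.val (γ t) (velocity (𝓡 4) γ t) (velocity (𝓡 4) γ t) = 0 ∧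
        velocity (𝓡 4) γ t ≠ 0 ∧ 𝓑.metric.val (γ t) (velocity (𝓡 4) γ t) (𝓑.killing (γ t)) = 0)) →
    ¬ 𝓑.IsKillingModeStable

/-- **A mode-stable telescope hole with one maximal zero-energy null geodesic ANYWHERE in its
carrier** — e.g. Schwarzschild with a horizon generator (`T` is null and tangent on `𝓗⁺`, so the
generators are zero-energy null geodesics), or any rotating Kerr with an escaping zero-energy ray. -/
def StableHoleWithZeroEnergyGeodesic : Prop :=
  ∃ (𝓑 : StationaryAFBlackHole.{0}) (_ : 𝓑.metric.HasLeviCivita)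
    (U : Set 𝓑.carrier) (K : Π x : 𝓑.carrier, TangentSpace (𝓡 4) x),
    Telescope 𝓑 U K ∧ 𝓑.IsKillingModeStable ∧ ∃ (γ : ℝ → 𝓑.carrier) (s : Set ℝ),
      IsMaximalGeodesicOn 𝓑.metric.toPseudoRiemannianMetric.leviCivita γ s ∧ s.Nonempty ∧
      ∀ t ∈ s, 𝓑.metric.val (γ t) (velocity (𝓡 4) γ t) (velocity (𝓡 4) γ t) = 0 ∧
        velocity (𝓡 4) γ t ≠ 0 ∧ 𝓑.metric.val (γ t) (velocity (𝓡 4) γ t) (𝓑.killing (γ t)) = 0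

/-- **The orbit clause (trapping mod `T`) is load-bearing**: without it `S := ∅` is admissible and
any maximal zero-energy null geodesic — a horizon generator — triggers the conclusion.
[cite: ShlapentokhRothman2015ModeStability, Thm. 1.5] -/
theorem withoutOrbit_false_of (h : StableHoleWithZeroEnergyGeodesic) :
    ¬ ErgoregionBombModTWithoutOrbit := by
  rintro hW
  obtain ⟨𝓑, _, U, K, hT, hS, γ, s, hγ, hs, hz⟩ := h
  haveI : Kerr.Facts := ZeroEnergyRigidity.Negative.kerrFacts
  exact hW 𝓑 U K hT ⟨∅, isCompact_empty, empty_subset _, γ, s, hγ, hs, hz⟩ hS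

/-- **The crux with the ZERO-ENERGY clause deleted** (`g(γ̇, T) = 0` removed: any null geodesic
trapped mod `T`). -/
def ErgoregionBombModTWithoutZeroEnergy : Prop :=
  ∀ (𝓑 : StationaryAFBlackHole.{0}) [𝓑.metric.HasLeviCivita] [Kerr.Facts]
    (U : Set 𝓑.carrier) (K : Π x : 𝓑.carrier, TangentSpace (𝓡 4) x), Telescope 𝓑 U K →
    (∃ S : Set 𝓑.carrier, IsCompact S ∧ S ⊆ 𝓑.doc ∧ ∃ (γ : ℝ → 𝓑.carrier) (s : Set ℝ),
      IsMaximalGeodesicOn 𝓑.metric.toPseudoRiemannianMetric.leviCivita γ s ∧ s.Nonempty ∧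
      (∀ t ∈ s, 𝓑.metric.val (γ t) (velocity (𝓡 4) γ t) (velocity (𝓡 4) γ t) = 0 ∧
        velocity (𝓡 4) γ t ≠ 0) ∧
      ∀ t ∈ s, γ t ∈ stationaryOrbit 𝓑.killing S) →
    ¬ 𝓑.IsKillingModeStable

/-- **A mode-stable telescope hole with a null geodesic of ANY energy trapped mod `T`** — Schwarzschild
with its photon sphere `r = 3M` (or any sub-extremal Kerr with a spherical photon orbit). -/
def StableHoleWithTrappedNullGeodesic : Prop :=
  ∃ (𝓑 : StationaryAFBlackHole.{0}) (_ : 𝓑.metric.HasLeviCivita)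
    (U : Set 𝓑.carrier) (K : Π x : 𝓑.carrier, TangentSpace (𝓡 4) x),
    Telescope 𝓑 U K ∧ 𝓑.IsKillingModeStable ∧
    ∃ S : Set 𝓑.carrier, IsCompact S ∧ S ⊆ 𝓑.doc ∧ ∃ (γ : ℝ → 𝓑.carrier) (s : Set ℝ),
      IsMaximalGeodesicOn 𝓑.metric.toPseudoRiemannianMetric.leviCivita γ s ∧ s.Nonempty ∧
      (∀ t ∈ s, 𝓑.metric.val (γ t) (velocity (𝓡 4) γ t) (velocity (𝓡 4) γ t) = 0 ∧
        velocity (𝓡 4) γ t ≠ 0) ∧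
      ∀ t ∈ s, γ t ∈ stationaryOrbit 𝓑.killing S

/-- **Zero energy is load-bearing**: ordinary (E ≠ 0) trapping — the photon sphere — lives on
mode-stable holes. [cite: ShlapentokhRothman2015ModeStability, Thm. 1.5] -/
theorem withoutZeroEnergy_false_of (h : StableHoleWithTrappedNullGeodesic) :
    ¬ ErgoregionBombModTWithoutZeroEnergy := by
  rintro hW
  obtain ⟨𝓑, _, U, K, hT, hS, htrap⟩ := h
  haveI : Kerr.Facts := ZeroEnergyRigidity.Negative.kerrFacts
  exact hW 𝓑 U K hT htrap hS

/-! ## §6  The expected countermodel species (recorded as the conditional it is) -/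

/-- THE EXPECTED COUNTERMODEL (a conditional, trivially a dark-hair hole): the antecedent admits maximal
zero-energy null geodesics with domain `s ≠ univ` (incomplete in one affine direction while confined
mod `T`: the anisochronous, blueshifted closed rays of the ideators' negative note, generic in the
non-axisymmetric class; by strong causality of `doc` the Killing time along such an end is unbounded).
For that species only NON-modal linear growth is expected (radial-sink threshold `H^{1/2+ν/κ₀}` at
`Γ₀`), so the typed SMOOTH modal conclusion should fail on a vacuum hole whose `Γ₀` consists of such
rays — 'dark hair of the second kind'. Obstruction to closing: no vacuum stationary black hole other
than Kerr can be written down, let alone certified mode-stable (a Whiting-level theorem); tried: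
flat carriers (no ergoregion), periodic quotients (not `I⁺`-regular), Kerr–Schild Kerr (`Γ₀ = ∅`). -/
theorem false_of_incompleteSpeciesHole :
    (∃ (𝓑 : StationaryAFBlackHole.{0}) (_ : 𝓑.metric.HasLeviCivita)
      (U : Set 𝓑.carrier) (K : Π x : 𝓑.carrier, TangentSpace (𝓡 4) x),
      Telescope 𝓑 U K ∧ 𝓑.IsKillingModeStable ∧
      ∃ S : Set 𝓑.carrier, IsCompact S ∧ S ⊆ 𝓑.doc ∧ ∃ (γ : ℝ → 𝓑.carrier) (s : Set ℝ),
        IsMaximalGeodesicOn 𝓑.metric.toPseudoRiemannianMetric.leviCivita γ s ∧ s.Nonempty ∧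
        s ≠ univ ∧
        (∀ t ∈ s, 𝓑.metric.val (γ t) (velocity (𝓡 4) γ t) (velocity (𝓡 4) γ t) = 0 ∧
          velocity (𝓡 4) γ t ≠ 0 ∧ 𝓑.metric.val (γ t) (velocity (𝓡 4) γ t) (𝓑.killing (γ t)) = 0) ∧
        ∀ t ∈ s, γ t ∈ stationaryOrbit 𝓑.killing S) →
    ¬ ErgoregionBombModT := by
  rintro ⟨𝓑, _, U, K, hT, hS, S, hSc, hSd, γ, s, hγ, hs, -, hz, hin⟩
  rw [ergoregionBombModT_iff_noDarkHair, not_not]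
  exact ⟨𝓑, ‹_›, U, K, hT, ⟨S, hSc, hSd, γ, s, hγ, hs, hz, hin⟩, hS⟩

/-! ## §7  Targets (the lead's stuck stubs)

None yet: at cycle 1 no line is picked (`PICKED.md` absent, payload `stuck_stubs = []`). When a
skeleton is registered its stubs become targets here; by §3/§5 any stub that forgets `γ̇ ≠ 0`,
maximality, the orbit clause or zero energy is refutable modulo a mode-stable Kerr presentation, and by
§4 any stub producing a mode bounded on the whole d.o.c. is refutable outright
(`not_conclusion_docBounded`).

NEAREST PRINTS AGAINST THE MECHANISM (not telescope members, recorded for the lead): the evanescent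
ergosurface of supersymmetric microstate geometries is a submanifold of null geodesic `T`-orbits with
`g(T,T) = 0` — exactly the minimal antecedent of §1 — and carries zero-energy stable trapping, yet
linear waves there are uniformly bounded with only logarithmic decay (Eperon–Reall–Santos
arXiv:1607.06828; Keir arXiv:1609.01733, arXiv:1810.03026): zero-energy trapping WITHOUT a growing
mode, in horizonless non-vacuum geometries. The crux survives them only through `IsConnected 𝓑.horizon`
(non-empty horizon) and `IsRicciFlat`; its bet is that a rotating non-degenerate VACUUM horizon next to
`Γ₀` turns Friedman's mechanism modal. -/

end Summit.FinalStateConjecture.FinalStateConjecture.Cruxes.ErgoregionBombModT.Disproof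

end
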